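import Summits.Ventures.YMGap.Thresholds.SharpClusteringCovariance
import Summits.Ventures.YMGap.Thresholds.LatticeBakryEmeryLipschitz
import HarnessLib

/-!
# Venture YMGap — static exponential clustering, Part III-b:
# exponential decay of the unnormalised covariance from a distance function (any finite link set)

HONEST FRAMING: venture file (cell `pub-ymgap`, track (a), seat lit-1). Generic in the finite link
type `ι` and the smooth polynomial potential `S` on `SU(N)^ι`; no lattice geometry, no number about
Yang–Mills. This is the common core of the torus instance (`SharpClusteringTorus`, states
`μ_{Λ_L,Nβ}`) and the region-kernel instance (`SharpClusteringRegion`, DLR kernels `γ_E(·|η)`).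

Given the data of Part III's `covariance_le` WITHOUT the weights — `HessBound S Λ`,
`OffDiagHessBound S h` (`h ≥ 0` symmetric, row sums `≤ H`, `H ≥ 0`), `K = N/2 - Λ > 0` — and an
`ℕ`-valued function `D` on the links that is `1`-Lipschitz across interacting pairs
(`h e e' ≠ 0 → D e ≤ D e' + 1`), the weights `w_e = e^{2κ D(e)}` are admissible with `ρ = e^{2κ}`, and
for `κ = min 1 (K/(4H+1))` the weighted constant is `K_c = K - (e^κ - 1)H ≥ K/2`
(`half_le_weightedConst`). If moreover `D = 0` on the links carrying the Lipschitz data `δv` of `v`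
and `D ≥ m` on those carrying `δu`, then (`cov_exp_decay_of_distFun`)

  `|Z ∫ e^S uv - (∫ e^S u)(∫ e^S v)| ≤ Z² · (2/K) e^{-κ m} (Σ_e δu_e)(Σ_e δv_e)`, `Z = ∫ e^S dσ^{⊗ι}`,

using the weighted per-link frame bound `Γ^w(u,u) ≤ Σ_e w_e δu_e²` (`GamW_le_of_linkLipschitz`, from
p2's `LatticeBakryEmeryLipschitz`).

## References

* H. Shen, R. Zhu, X. Zhu, CMP 400 (2023) 805–851, Cor. 4.11 / Remark 4.12.
* B. Helffer, J. Funct. Anal. 155 (1998) 571–586 (weighted-energy route to correlation decay).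
-/

noncomputable section

open scoped Matrix ComplexConjugate BigOperators Matrix.Norms.Frobenius ContDiff Topology
open Matrix Complex Finset MeasureTheory Filter
open Literature.MathematicalPhysics.QuantumFieldTheory
open Literature.MathematicalPhysics.QuantumFieldTheory.SUNBakryEmery (SUN FrameIdx frame)

namespace Summit.Ventures.YMGap

namespace SharpClustering

open LatticeBakryEmery

universe u

/-! ### Weighted gradient bounds for per-link Lipschitz functions -/

section LinkLipschitzW

variable {ι : Type u} [Fintype ι] [DecidableEq ι] {N : ℕ}

/-- `Γ^w(u,u) ≤ ∑_e w_e L_e²` on `SU(N)^E` for nonnegative weights and a smooth per-link Lipschitz `u`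
(the per-link frame bound of p2's `LatticeBakryEmeryLipschitz`, weighted). -/
theorem GamW_le_of_linkLipschitz (hN : N ≠ 0) {w : ι → ℝ} (hw : ∀ e, 0 ≤ w e) {u : Cfg ι N → ℝ}
    (hu : ContDiff ℝ ∞ u) {Lc : ι → ℝ} (hL : ∀ e, 0 ≤ Lc e) (hLip : LinkLipschitz u Lc) (g : PSU ι N) :
    GamW w u u (emb g) ≤ ∑ e, w e * Lc e ^ 2 := by
  have hGe : GamW w u u (emb g) = ∑ e : ι, w e * ∑ α : FrameIdx N, linkFun u (emb g) e (frame α) ^ 2 := by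
    rw [GamW_self_eq_sum_sq, Fintype.sum_prod_type]
    refine sum_congr rfl fun e _ => ?_
    rw [mul_sum]
    refine sum_congr rfl fun α _ => ?_
    simp only [bframe, linkFun_apply]
  rw [hGe]
  refine sum_le_sum fun e _ => mul_le_mul_of_nonneg_left ?_ (hw e)
  exact sum_sq_apply_frame_le_of_skew hN (linkFun u (emb g) e) fun A hA hA0 => by
    rw [linkFun_apply]; exact abs_algD_lk_le_of_linkLipschitz hu hL hLip g e hA hA0

/-- If the weight is `≤ c` wherever the Lipschitz datum is nonzero: `Γ^w(u,u) ≤ c (∑_e L_e)²`. -/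
theorem GamW_le_mul_sq_sum (hN : N ≠ 0) {w : ι → ℝ} (hw : ∀ e, 0 ≤ w e) {u : Cfg ι N → ℝ}
    (hu : ContDiff ℝ ∞ u) {Lc : ι → ℝ} (hL : ∀ e, 0 ≤ Lc e) (hLip : LinkLipschitz u Lc) {c : ℝ} (hc : 0 ≤ c)
    (hwc : ∀ e, Lc e ≠ 0 → w e ≤ c) (g : PSU ι N) :
    GamW w u u (emb g) ≤ c * (∑ e, Lc e) ^ 2 := by
  refine (GamW_le_of_linkLipschitz hN hw hu hL hLip g).trans ?_
  have h1 : ∑ e, w e * Lc e ^ 2 ≤ ∑ e, c * Lc e ^ 2 := by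
    refine sum_le_sum fun e _ => ?_
    by_cases h0 : Lc e = 0
    · rw [h0]; simp
    · exact mul_le_mul_of_nonneg_right (hwc e h0) (sq_nonneg _)
  refine h1.trans ?_
  rw [← mul_sum]
  exact mul_le_mul_of_nonneg_left (sum_sq_le_sq_sum_of_nonneg fun e _ => hL e) hc

end LinkLipschitzW

/-! ### The rate `κ` and the weighted constant `K_c ≥ K/2` -/

section Rate

/-- `e^κ - 1 ≤ 2κ` for `0 ≤ κ ≤ 1`. -/
theorem exp_sub_one_le_two_mul {κ : ℝ} (h0 : 0 ≤ κ) (h1 : κ ≤ 1) : Real.exp κ - 1 ≤ 2 * κ := by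
  have h := Real.abs_exp_sub_one_sub_id_le (x := κ) (by rw [abs_of_nonneg h0]; exact h1)
  have h2 := (abs_le.1 h).2
  nlinarith

/-- **The weighted constant is at least half the Bakry–Émery constant**: with
`κ = min 1 (K/(4H₊+1))`, `H₊ ≥ 0`, `K > 0`: `K/2 ≤ K - (√(e^{2κ}) - 1) H₊`. -/
theorem half_le_weightedConst {K H : ℝ} (hK : 0 < K) (hH : 0 ≤ H) :
    K / 2 ≤ K - (Real.sqrt (Real.exp (2 * min 1 (K / (4 * H + 1)))) - 1) * H := by
  set κ : ℝ := min 1 (K / (4 * H + 1)) with hκ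
  have hκ0 : 0 ≤ κ := le_min zero_le_one (div_nonneg hK.le (by positivity))
  have hκ1 : κ ≤ 1 := min_le_left _ _
  have hκK : κ ≤ K / (4 * H + 1) := min_le_right _ _
  have hsq : Real.sqrt (Real.exp (2 * κ)) = Real.exp κ := by
    rw [show (2 : ℝ) * κ = κ + κ by ring, Real.exp_add, Real.sqrt_mul_self (Real.exp_pos κ).le]
  rw [hsq]
  have h1 : (Real.exp κ - 1) * H ≤ 2 * κ * H := mul_le_mul_of_nonneg_right (exp_sub_one_le_two_mul hκ0 hκ1) hH
  have h2 : 2 * κ * H ≤ K / 2 := by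
    have h3 : κ * (4 * H + 1) ≤ K := by
      have := (le_div_iff₀ (by positivity : (0 : ℝ) < 4 * H + 1)).1 hκK
      linarith
    nlinarith
  linarith

/-- The rate is positive. -/
theorem rate_pos {K H : ℝ} (hK : 0 < K) (hH : 0 ≤ H) : 0 < min 1 (K / (4 * H + 1)) :=
  lt_min zero_lt_one (div_pos hK (by positivity))

end Rate

/-! ### The decay estimate from a distance function -/

section Decay

variable {ι : Type u} [Fintype ι] [DecidableEq ι] {N : ℕ}

/-- **Exponential decay of the unnormalised covariance from a distance function** (generic link
set). See the module docstring; `κ = min 1 (K/(4H+1))`, `K = N/2 - Λ`. -/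
theorem cov_exp_decay_of_distFun (hN : N ≠ 0) {dS : ℕ} {S : Cfg ι N → ℝ} (hSp : S ∈ polySpace ι N dS)
    {Λ : ℝ} (hHess : HessBound S Λ) (hK : 0 < (N : ℝ) / 2 - Λ)
    {h : ι → ι → ℝ} (hOff : OffDiagHessBound S h) (hh0 : ∀ e e', 0 ≤ h e e')
    (hsymm : ∀ e e', h e e' = h e' e) {H : ℝ} (hH0 : 0 ≤ H) (hrow : ∀ e, ∑ e', h e e' ≤ H)
    (D : ι → ℕ) (hD : ∀ e e', h e e' ≠ 0 → D e ≤ D e' + 1)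
    {u v : Cfg ι N → ℝ} (hu : ContDiff ℝ ∞ u) (hv : ContDiff ℝ ∞ v)
    {δu δv : ι → ℝ} (hδu : ∀ e, 0 ≤ δu e) (hδv : ∀ e, 0 ≤ δv e)
    (hLu : LinkLipschitz u δu) (hLv : LinkLipschitz v δv)
    (hDv : ∀ e, δv e ≠ 0 → D e = 0) {m : ℕ} (hDu : ∀ e, δu e ≠ 0 → m ≤ D e) :
    |(∫ x : PSU ι N, Real.exp (S (emb x)) ∂(haarPi ι N)) *
          (∫ x : PSU ι N, Real.exp (S (emb x)) * (u (emb x) * v (emb x)) ∂(haarPi ι N)) -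
        (∫ x : PSU ι N, Real.exp (S (emb x)) * u (emb x) ∂(haarPi ι N)) *
          (∫ x : PSU ι N, Real.exp (S (emb x)) * v (emb x) ∂(haarPi ι N))| ≤
      (∫ x : PSU ι N, Real.exp (S (emb x)) ∂(haarPi ι N)) ^ 2 *
        (2 / ((N : ℝ) / 2 - Λ) * Real.exp (-(min 1 (((N : ℝ) / 2 - Λ) / (4 * H + 1))) * m) *
          (∑ e, δu e) * (∑ e, δv e)) := by
  -- constants
  set K : ℝ := (N : ℝ) / 2 - Λ with hKdef
  set κ : ℝ := min 1 (K / (4 * H + 1)) with hκ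
  have hκpos : 0 < κ := rate_pos hK hH0
  set ρ : ℝ := Real.exp (2 * κ) with hρ
  have hρ1 : 1 ≤ ρ := Real.one_le_exp (by positivity)
  set Kc : ℝ := (N : ℝ) / 2 - Λ - (Real.sqrt ρ - 1) * H with hKc
  have hKc : K / 2 ≤ Kc := half_le_weightedConst hK hH0
  have hKcpos : 0 < Kc := lt_of_lt_of_le (half_pos hK) hKc
  have hS : ContDiff ℝ ∞ S := contDiff_of_mem_polySpace hSp
  -- the weights
  set w : ι → ℝ := fun e => Real.exp (2 * κ * D e) with hw
  have hwpos : ∀ e, 0 < w e := fun e => Real.exp_pos _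
  have hw0 : ∀ e, 0 ≤ w e := fun e => (hwpos e).le
  have hadm : AdmissibleWeights h ρ w := by
    refine ⟨hwpos, fun e e' _ hne => ?_⟩
    have h1 := hD e e' hne
    have h2 : (2 * κ * D e : ℝ) ≤ 2 * κ + 2 * κ * D e' := by
      have : (D e : ℝ) ≤ D e' + 1 := by exact_mod_cast h1
      nlinarith
    calc w e = Real.exp (2 * κ * D e) := rfl
      _ ≤ Real.exp (2 * κ + 2 * κ * D e') := Real.exp_le_exp.2 h2
      _ = ρ * w e' := by rw [Real.exp_add]
  -- Part III
  have hmain := covariance_le hN hSp hHess hOff hh0 hsymm hrow hρ1 hadm hKcpos hu hv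
  -- the gradient bounds
  have hGu : ∀ g : PSU ι N, GamW (fun e => (w e)⁻¹) u u (emb g) ≤ Real.exp (-(2 * κ * m)) * (∑ e, δu e) ^ 2 := by
    intro g
    refine GamW_le_mul_sq_sum hN (fun e => inv_nonneg.2 (hw0 e)) hu hδu hLu (Real.exp_pos _).le
      (fun e he => ?_) g
    rw [← Real.exp_neg]
    refine Real.exp_le_exp.2 ?_
    have : (m : ℝ) ≤ D e := by exact_mod_cast hDu e he
    nlinarith [hκpos.le]
  have hGv : ∀ g : PSU ι N, GamW w v v (emb g) ≤ 1 * (∑ e, δv e) ^ 2 := by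
    intro g
    refine GamW_le_mul_sq_sum hN hw0 hv hδv hLv zero_le_one (fun e he => ?_) g
    show Real.exp (2 * κ * D e) ≤ 1
    rw [hDv e he, Nat.cast_zero, mul_zero, Real.exp_zero]
  -- integrate the gradient bounds against `e^S`
  set Z : ℝ := ∫ U, Real.exp (S (emb U)) ∂(haarPi ι N) with hZ
  have hSc : Continuous fun U : PSU ι N => S (emb U) := continuous_restrict hS
  have hEc : Continuous fun U : PSU ι N => Real.exp (S (emb U)) := Real.continuous_exp.comp hSc
  have hZpos : 0 < Z := integral_exp_pos (integrable_of_continuous_PSU hEc _)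
  have hIu : ∫ U, Real.exp (S (emb U)) * GamW (fun e => (w e)⁻¹) u u (emb U) ∂(haarPi ι N) ≤
      Z * (Real.exp (-(2 * κ * m)) * (∑ e, δu e) ^ 2) := by
    rw [hZ, ← integral_mul_const]
    refine integral_mono (integrable_of_continuous_PSU (hEc.mul (continuous_restrict (contDiff_GamW _ hu hu))) _)
      ((integrable_of_continuous_PSU hEc _).mul_const _) fun U => ?_
    exact mul_le_mul_of_nonneg_left (hGu U) (Real.exp_pos _).le
  have hIv : ∫ U, Real.exp (S (emb U)) * GamW w v v (emb U) ∂(haarPi ι N) ≤ Z * (1 * (∑ e, δv e) ^ 2) := by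
    rw [hZ, ← integral_mul_const]
    refine integral_mono (integrable_of_continuous_PSU (hEc.mul (continuous_restrict (contDiff_GamW _ hv hv))) _)
      ((integrable_of_continuous_PSU hEc _).mul_const _) fun U => ?_
    exact mul_le_mul_of_nonneg_left (hGv U) (Real.exp_pos _).le
  have hsu : 0 ≤ ∑ e, δu e := sum_nonneg fun e _ => hδu e
  have hsv : 0 ≤ ∑ e, δv e := sum_nonneg fun e _ => hδv e
  have hsqu : Real.sqrt (∫ U, Real.exp (S (emb U)) * GamW (fun e => (w e)⁻¹) u u (emb U) ∂(haarPi ι N)) ≤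
      Real.sqrt Z * (Real.exp (-(κ * m)) * ∑ e, δu e) := by
    refine (Real.sqrt_le_sqrt hIu).trans (le_of_eq ?_)
    have e1 : Real.exp (-(2 * κ * m)) = Real.exp (-(κ * m)) ^ 2 := by
      rw [← Real.exp_nat_mul]; congr 1; push_cast; ring
    rw [e1, ← mul_pow, Real.sqrt_mul hZpos.le, Real.sqrt_sq (mul_nonneg (Real.exp_pos _).le hsu)]
  have hsqv : Real.sqrt (∫ U, Real.exp (S (emb U)) * GamW w v v (emb U) ∂(haarPi ι N)) ≤
      Real.sqrt Z * ∑ e, δv e := by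
    refine (Real.sqrt_le_sqrt hIv).trans (le_of_eq ?_)
    rw [one_mul, Real.sqrt_mul hZpos.le, Real.sqrt_sq hsv]
  -- the unnormalised covariance
  set Cu : ℝ := Z * (∫ U, Real.exp (S (emb U)) * (u (emb U) * v (emb U)) ∂(haarPi ι N)) -
      (∫ U, Real.exp (S (emb U)) * u (emb U) ∂(haarPi ι N)) *
        (∫ U, Real.exp (S (emb U)) * v (emb U) ∂(haarPi ι N)) with hCu
  have hCu_le : Kc * |Cu| ≤ Z * (Real.sqrt Z * (Real.exp (-(κ * m)) * ∑ e, δu e) * (Real.sqrt Z * ∑ e, δv e)) := by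
    refine hmain.trans (mul_le_mul_of_nonneg_left ?_ hZpos.le)
    exact mul_le_mul hsqu hsqv (Real.sqrt_nonneg _) (mul_nonneg (Real.sqrt_nonneg _) (by positivity))
  have hZZ : Real.sqrt Z * Real.sqrt Z = Z := Real.mul_self_sqrt hZpos.le
  have hexp : Real.exp (-(κ * m)) = Real.exp (-κ * m) := by rw [neg_mul]
  have hprod : 0 ≤ Real.exp (-κ * m) * (∑ e, δu e) * (∑ e, δv e) := by positivity
  have hZ2 : 0 ≤ Z ^ 2 := sq_nonneg _
  have h2 : 1 ≤ 2 / K * Kc := by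
    rw [div_mul_eq_mul_div, le_div_iff₀ hK]; linarith
  have key : Kc * |Cu| ≤ Kc * (Z ^ 2 * (2 / K * Real.exp (-κ * m) * (∑ e, δu e) * (∑ e, δv e))) := by
    calc Kc * |Cu| ≤ Z * (Real.sqrt Z * (Real.exp (-(κ * m)) * ∑ e, δu e) * (Real.sqrt Z * ∑ e, δv e)) := hCu_le
      _ = Z ^ 2 * (Real.exp (-κ * m) * (∑ e, δu e) * (∑ e, δv e)) := by
          rw [hexp, show Z * (Real.sqrt Z * (Real.exp (-κ * m) * ∑ e, δu e) * (Real.sqrt Z * ∑ e, δv e)) =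
            Z * (Real.sqrt Z * Real.sqrt Z) * (Real.exp (-κ * m) * (∑ e, δu e) * (∑ e, δv e)) by ring, hZZ]
          ring
      _ = 1 * (Z ^ 2 * (Real.exp (-κ * m) * (∑ e, δu e) * (∑ e, δv e))) := (one_mul _).symm
      _ ≤ (2 / K * Kc) * (Z ^ 2 * (Real.exp (-κ * m) * (∑ e, δu e) * (∑ e, δv e))) :=
          mul_le_mul_of_nonneg_right h2 (mul_nonneg hZ2 hprod)
      _ = Kc * (Z ^ 2 * (2 / K * Real.exp (-κ * m) * (∑ e, δu e) * (∑ e, δv e))) := by ring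
  exact le_of_mul_le_mul_left key hKcpos

end Decay

end SharpClustering

end Summit.Ventures.YMGap
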